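import Mathlib
import Literature.NumberTheory.Transcendental.KZMellinFibres
import Summits.KontsevichZagierPeriods.KontsevichZagierPeriods.Theorems.InverseLandauTateFamilyKernelTateAnchor
import Summits.KontsevichZagierPeriods.KontsevichZagierPeriods.Theorems.InverseLandauTateFamilyKernelTameCertificate

/-!
# `TateFamilyKernel` toolkit — rational certificates at a real-algebraic parameter

Crux `TateFamilyKernel` (stmt-KontsevichZagierPeriods-9130, route `InverseLandau`). Packaging of
`tame_certificate` (file `InverseLandauTateFamilyKernelTameCertificate.lean`) for the data every
certificate line actually produces: RATIONAL functions `A_k/D_k` of the `n + m` cube variables and the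
parameter `ϖ` with `ℚ`-coefficients, evaluated at a real-ALGEBRAIC `ϖ₀` (last variable), with
`D_k(·, ϖ₀) ≠ 0` on the closed cube. All analysis (analyticity near the cube, `ℚ`-semialgebraicity of
the slices, the partial derivatives by the quotient rule) is discharged here, so that a line only has to
supply the ALGEBRAIC identity

  `P(z,ϖ₀)/Q(z,ϖ₀) = Σ_k ( ∂_{i_k}(A_k/D_k) − (A_k/D_k)|_{w_{i_k}=1} + (A_k/D_k)|_{w_{i_k}=0} )(w, ϖ₀)`

pointwise on `[0,1]^{n+m}` (`z` = the first `n` coordinates of `w`) — `rational_certificate`.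

Card rational-cube-certificates (conjecture RC′) also admits RULE-(2) kernel elements `h − h ∘ σ` for
symmetries `σ` of the cube (coordinate permutations, reflections `x_j ↦ 1 − x_j`); for tame `h` these
are relations by one change-of-variables move each (`tame_sub_comp_equiv_mem_relations`,
`tame_sub_boxReflection_mem_relations`), so a certificate = relA part + symmetry part still lands in
`KZ.relations` by integrand additivity. No named fact, no new definition.
-/

noncomputable section

open MeasureTheory Set MvPolynomial
open Literature.NumberTheory.Transcendental
open Literature.ModelTheory.ExponentialFields (IsSemialgebraic)

namespace Summit.KontsevichZagierPeriods.InverseLandau.TateFamilyKernel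

variable {D : ℕ}

/-- The slice at `ϖ₀` of a ratio of `ℚ`-polynomials in `D + 1` variables is analytic near `[0,1]^D`
when the denominator does not vanish there. [folklore] -/
theorem analyticOnNhd_slice (A B : MvPolynomial (Fin (D + 1)) ℚ) (ϖ₀ : ℝ)
    (hB : ∀ w ∈ KZ.cube D, aeval (Fin.snoc w ϖ₀ : Fin (D + 1) → ℝ) B ≠ 0) :
    AnalyticOnNhd ℝ (fun w : Fin D → ℝ =>
      aeval (Fin.snoc w ϖ₀ : Fin (D + 1) → ℝ) A / aeval (Fin.snoc w ϖ₀ : Fin (D + 1) → ℝ) B) (KZ.cube D) :=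
  fun w hw => analyticAt_aeval_div_aeval_snoc ϖ₀ A B (hB w hw)

/-- The slice at a real-algebraic `ϖ₀` of a ratio of `ℚ`-polynomials is `ℚ`-semialgebraic on `[0,1]^D`
when the denominator does not vanish there. [cite: BochnakCosteRoy1998, Prop. 2.2.6] -/
theorem isSemialgebraicFunOn_slice (A B : MvPolynomial (Fin (D + 1)) ℚ) {ϖ₀ : ℝ} (hϖ₀ : IsAlgebraic ℚ ϖ₀)
    (hB : ∀ w ∈ KZ.cube D, aeval (Fin.snoc w ϖ₀ : Fin (D + 1) → ℝ) B ≠ 0) :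
    IsSemialgebraicFunOn ℚ (KZ.cube D) (fun w : Fin D → ℝ =>
      aeval (Fin.snoc w ϖ₀ : Fin (D + 1) → ℝ) A / aeval (Fin.snoc w ϖ₀ : Fin (D + 1) → ℝ) B) :=
  isSemialgebraicFunOn_aeval_div_aeval_comp (isSemialgebraicMapOn_snoc_const KZ.isSemialgebraic_cube hϖ₀) A B hB

/-- **Partial derivative of a slice** along a cube coordinate `i` (quotient rule):
`∂ᵢ (A/B)(w, ϖ₀) = ((∂ᵢA·B − A·∂ᵢB)/B²)(w, ϖ₀)`, `∂ᵢ = MvPolynomial.pderiv (Fin.castSucc i)`. [folklore] -/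
theorem hasDerivAt_slice_update (A B : MvPolynomial (Fin (D + 1)) ℚ) (ϖ₀ : ℝ) (i : Fin D) (w : Fin D → ℝ)
    (hB : aeval (Fin.snoc w ϖ₀ : Fin (D + 1) → ℝ) B ≠ 0) :
    HasDerivAt (fun t : ℝ => aeval (Fin.snoc (Function.update w i t) ϖ₀ : Fin (D + 1) → ℝ) A /
        aeval (Fin.snoc (Function.update w i t) ϖ₀ : Fin (D + 1) → ℝ) B)
      (aeval (Fin.snoc w ϖ₀ : Fin (D + 1) → ℝ) (pderiv (Fin.castSucc i) A * B - A * pderiv (Fin.castSucc i) B) /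
        aeval (Fin.snoc w ϖ₀ : Fin (D + 1) → ℝ) (B ^ 2)) (w i) := by
  have hpt : Function.update (Fin.snoc w ϖ₀ : Fin (D + 1) → ℝ) (Fin.castSucc i) (w i) = Fin.snoc w ϖ₀ := by
    rw [← Fin.snoc_update, Function.update_eq_self]
  have h := KZ.hasDerivAt_aeval_div_aeval_update A B (Fin.snoc w ϖ₀ : Fin (D + 1) → ℝ) (Fin.castSucc i) (w i)
    (by rw [hpt]; exact hB)
  rw [hpt] at h
  have hfun : (fun t : ℝ => aeval (Fin.snoc (Function.update w i t) ϖ₀ : Fin (D + 1) → ℝ) A /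
      aeval (Fin.snoc (Function.update w i t) ϖ₀ : Fin (D + 1) → ℝ) B) =
      fun t => aeval (Function.update (Fin.snoc w ϖ₀ : Fin (D + 1) → ℝ) (Fin.castSucc i) t) A /
        aeval (Function.update (Fin.snoc w ϖ₀ : Fin (D + 1) → ℝ) (Fin.castSucc i) t) B := by
    funext t
    rw [Fin.snoc_update]
  rw [hfun]
  refine h.congr_deriv ?_
  simp only [map_sub, map_mul, map_pow]

/-! ### Rule (2): cube symmetries of tame data are relations -/

/-- **Permutation symmetry.** For tame `h` on `[0,1]^D` and a coordinate permutation `e`, every tame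
representation of `h − h ∘ (· ∘ e)` is a relation (one change-of-variables move,
`KZ.of_sub_of_reindex_mem_relations`, plus linearity). [cite: KontsevichZagier2001, §1.2 rule (2)] -/
theorem tame_sub_comp_equiv_mem_relations (e : Fin D ≃ Fin D) {h : (Fin D → ℝ) → ℝ}
    (hha : AnalyticOnNhd ℝ h (KZ.cube D)) (hhs : IsSemialgebraicFunOn ℚ (KZ.cube D) h)
    (S : KZ.IntegralRep D) (hS : S.IsTameCube)
    (hSi : ∀ x ∈ KZ.cube D, S.integrand x = h x - h (fun j => x (e j))) :
    KZ.of S ∈ KZ.relations := by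
  set H : KZ.IntegralRep D := KZ.IntegralRep.tameCube h hha hhs with hH
  set He : KZ.IntegralRep D := KZ.IntegralRep.tameCube (fun x => h (fun j => x (e j)))
    (analyticOnNhd_comp_equiv hha e) (isSemialgebraicFunOn_comp_equiv hhs e) with hHe
  have h1 : KZ.of H - KZ.of (H.reindex e) ∈ KZ.relations := KZ.of_sub_of_reindex_mem_relations H e
  have h2 : KZ.of (H.reindex e) - KZ.of He ∈ KZ.relations := by
    refine KZ.of_sub_of_mem_relations_of_eqOn ?_ fun w _ => ?_
    · rw [hHe, KZ.IntegralRep.tameCube_domain, KZ.IntegralRep.reindex_domain, hH,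
        KZ.IntegralRep.tameCube_domain, setOf_comp_equiv_mem_cube]
    · simp [hH, hHe]
  have h3 : KZ.of H - KZ.of S - KZ.of He ∈ KZ.relations :=
    KZ.cubicalLinGens_subset_relations (KZ.mem_cubicalLinGens (KZ.IntegralRep.isTameCube_tameCube _ _ _) hS
      (KZ.IntegralRep.isTameCube_tameCube _ _ _) fun x hx => by simp [hH, hHe, hSi x hx])
  have : KZ.of S = (KZ.of H - KZ.of (H.reindex e)) + (KZ.of (H.reindex e) - KZ.of He) -
      (KZ.of H - KZ.of S - KZ.of He) := by abel
  rw [this]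
  exact KZ.relations.sub_mem (KZ.relations.add_mem h1 h2) h3

/-- A box reflection preserves the closed cube. [folklore] -/
theorem boxReflection_mem_cube (j : Fin D) {x : Fin D → ℝ} (hx : x ∈ KZ.cube D) :
    KZ.boxReflection j x ∈ KZ.cube D := by
  intro i
  by_cases h : i = j
  · subst h
    have := KZ.mem_cube.1 hx i
    simp only [KZ.boxReflection_apply_self]
    constructor <;> linarith [this.1, this.2]
  · rw [KZ.boxReflection_apply_of_ne h]
    exact KZ.mem_cube.1 hx i

/-- The closed cube is its own preimage under a box reflection. [folklore] -/
theorem boxReflection_preimage_cube (j : Fin D) : KZ.boxReflection j ⁻¹' KZ.cube D = KZ.cube D := by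
  ext x
  refine ⟨fun hx => ?_, fun hx => boxReflection_mem_cube j hx⟩
  have := boxReflection_mem_cube j hx
  rwa [KZ.boxReflection_boxReflection] at this

/-- A box reflection is the affine map `x ↦ x + (1 − 2 x_j) e_j`; in particular it is analytic.
[folklore] -/
theorem analyticAt_boxReflection (j : Fin D) (x : Fin D → ℝ) : AnalyticAt ℝ (KZ.boxReflection j) x := by
  have hfun : KZ.boxReflection j = fun x : Fin D → ℝ =>
      x + (1 - 2 * x j) • (Pi.single j (1 : ℝ) : Fin D → ℝ) := by
    funext x
    funext i
    by_cases h : i = j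
    · subst h
      simp [KZ.boxReflection_apply_self]
      ring
    · simp [KZ.boxReflection_apply_of_ne h, Pi.single_eq_of_ne h]
  rw [hfun]
  have hj : AnalyticAt ℝ (fun x : Fin D → ℝ => x j) x :=
    (ContinuousLinearMap.proj (R := ℝ) (φ := fun _ : Fin D => ℝ) j).analyticAt x
  exact analyticAt_id.add (((analyticAt_const.sub (analyticAt_const.mul hj))).smul analyticAt_const)

/-- **Reflection symmetry.** For tame `h` on `[0,1]^D` and the reflection `x_j ↦ 1 − x_j`, every tame
representation of `h − h ∘ boxReflection j` is a relation (one change-of-variables move,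
`KZ.of_sub_of_mem_relations_of_boxReflection`, plus linearity). [cite: KontsevichZagier2001, §1.2 rule (2)] -/
theorem tame_sub_boxReflection_mem_relations (j : Fin D) {h : (Fin D → ℝ) → ℝ}
    (hha : AnalyticOnNhd ℝ h (KZ.cube D)) (hhs : IsSemialgebraicFunOn ℚ (KZ.cube D) h)
    (S : KZ.IntegralRep D) (hS : S.IsTameCube)
    (hSi : ∀ x ∈ KZ.cube D, S.integrand x = h x - h (KZ.boxReflection j x)) :
    KZ.of S ∈ KZ.relations := by
  -- the reflected integrand is tame
  have hra : AnalyticOnNhd ℝ (fun x => h (KZ.boxReflection j x)) (KZ.cube D) := fun x hx =>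
    (hha _ (boxReflection_mem_cube j hx)).comp (analyticAt_boxReflection j x)
  have hrs : IsSemialgebraicFunOn ℚ (KZ.cube D) (fun x => h (KZ.boxReflection j x)) := by
    have hmap : IsSemialgebraicMapOn ℚ (KZ.cube D) (KZ.boxReflection j) := by
      convert isSemialgebraicMapOn_aeval (R := ℝ) KZ.isSemialgebraic_cube (KZ.reflectSubst j) using 2 with z
      exact (KZ.aeval_reflectSubst_eq j z).symm
    exact IsSemialgebraicFunOn.comp_isSemialgebraicMapOn_holds hhs hmap fun x hx => boxReflection_mem_cube j hx
  set H : KZ.IntegralRep D := KZ.IntegralRep.tameCube h hha hhs with hH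
  set Hr : KZ.IntegralRep D := KZ.IntegralRep.tameCube _ hra hrs with hHr
  have h1 : KZ.of Hr - KZ.of H ∈ KZ.relations :=
    KZ.of_sub_of_mem_relations_of_boxReflection j
      (by rw [hHr, hH, KZ.IntegralRep.tameCube_domain, KZ.IntegralRep.tameCube_domain,
        boxReflection_preimage_cube]) (fun x _ => by simp [hHr, hH])
  have h2 : KZ.of H - KZ.of S - KZ.of Hr ∈ KZ.relations :=
    KZ.cubicalLinGens_subset_relations (KZ.mem_cubicalLinGens (KZ.IntegralRep.isTameCube_tameCube _ _ _) hS
      (KZ.IntegralRep.isTameCube_tameCube _ _ _) fun x hx => by simp [hH, hHr, hSi x hx])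
  have : KZ.of S = -(KZ.of Hr - KZ.of H) - (KZ.of H - KZ.of S - KZ.of Hr) := by abel
  rw [this]
  exact KZ.relations.sub_mem (KZ.relations.neg_mem h1) h2

/-- **Rational certificates at a real-algebraic parameter.** Data: the fibre `P/Q` of the crux in
`n + 1` variables `(z, ϖ)`; certificate numerators/denominators `A_k, D_k` in `n + m + 1` variables
`(w, ϖ)` (`w ∈ [0,1]^{n+m}`, the first `n` of which are `z`) along coordinates `i_k`; a real-algebraic
`ϖ₀` with `Q(·,ϖ₀) ≠ 0` on `[0,1]ⁿ` and `D_k(·,ϖ₀) ≠ 0` on `[0,1]^{n+m}`; and the pointwise identity on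
`[0,1]^{n+m}` at `ϖ₀`
`P/Q (z,ϖ₀) = Σ_k [ (∂_{i_k}A_k·D_k − A_k·∂_{i_k}D_k)/D_k² (w,ϖ₀) − A_k/D_k (w|_{i_k}↦1, ϖ₀) + A_k/D_k (w|_{i_k}↦0, ϖ₀) ]`.
Conclusion: every tame representation of the fibre `F(·,ϖ₀)` lies in `KZ.relations` — hence (with
`of_mem_relations_of_isTameCube`) every representation the crux quantifies over.
[cite: Ayoub2014, Def. 10] [cite: KontsevichZagier2001, §1.1–1.2] -/
theorem rational_certificate {n m K : ℕ} (P Q : MvPolynomial (Fin (n + 1)) ℚ)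
    (A Dn : Fin K → MvPolynomial (Fin (n + m + 1)) ℚ) (i : Fin K → Fin (n + m))
    {ϖ₀ : ℝ} (hϖ₀ : IsAlgebraic ℚ ϖ₀)
    (hQ : ∀ z ∈ KZ.cube n, aeval (Fin.snoc z ϖ₀ : Fin (n + 1) → ℝ) Q ≠ 0)
    (hD : ∀ k, ∀ w ∈ KZ.cube (n + m), aeval (Fin.snoc w ϖ₀ : Fin (n + m + 1) → ℝ) (Dn k) ≠ 0)
    (hcert : ∀ w ∈ KZ.cube (n + m),
      aeval (Fin.snoc (fun j => w (Fin.castAdd m j)) ϖ₀ : Fin (n + 1) → ℝ) P /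
          aeval (Fin.snoc (fun j => w (Fin.castAdd m j)) ϖ₀ : Fin (n + 1) → ℝ) Q =
        ∑ k : Fin K,
          (aeval (Fin.snoc w ϖ₀ : Fin (n + m + 1) → ℝ)
              (pderiv (Fin.castSucc (i k)) (A k) * Dn k - A k * pderiv (Fin.castSucc (i k)) (Dn k)) /
            aeval (Fin.snoc w ϖ₀ : Fin (n + m + 1) → ℝ) (Dn k ^ 2)
          - aeval (Fin.snoc (Function.update w (i k) 1) ϖ₀ : Fin (n + m + 1) → ℝ) (A k) /
              aeval (Fin.snoc (Function.update w (i k) 1) ϖ₀ : Fin (n + m + 1) → ℝ) (Dn k)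
          + aeval (Fin.snoc (Function.update w (i k) 0) ϖ₀ : Fin (n + m + 1) → ℝ) (A k) /
              aeval (Fin.snoc (Function.update w (i k) 0) ϖ₀ : Fin (n + m + 1) → ℝ) (Dn k)))
    (Φ : KZ.IntegralRep n) (hΦ : Φ.IsTameCube)
    (hΦi : ∀ z ∈ KZ.cube n, Φ.integrand z =
      aeval (Fin.snoc z ϖ₀ : Fin (n + 1) → ℝ) P / aeval (Fin.snoc z ϖ₀ : Fin (n + 1) → ℝ) Q) :
    KZ.of Φ ∈ KZ.relations := by
  refine tame_certificate (Finset.univ : Finset (Fin K)) i (analyticOnNhd_slice P Q ϖ₀ hQ)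
    (isSemialgebraicFunOn_slice P Q hϖ₀ hQ)
    (G := fun k w => aeval (Fin.snoc w ϖ₀ : Fin (n + m + 1) → ℝ) (A k) /
      aeval (Fin.snoc w ϖ₀ : Fin (n + m + 1) → ℝ) (Dn k))
    (G' := fun k w => aeval (Fin.snoc w ϖ₀ : Fin (n + m + 1) → ℝ)
        (pderiv (Fin.castSucc (i k)) (A k) * Dn k - A k * pderiv (Fin.castSucc (i k)) (Dn k)) /
      aeval (Fin.snoc w ϖ₀ : Fin (n + m + 1) → ℝ) (Dn k ^ 2))
    (fun k _ => analyticOnNhd_slice (A k) (Dn k) ϖ₀ (hD k))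
    (fun k _ => isSemialgebraicFunOn_slice (A k) (Dn k) hϖ₀ (hD k))
    (fun k _ => analyticOnNhd_slice _ _ ϖ₀ fun w hw => ?_)
    (fun k _ => isSemialgebraicFunOn_slice _ _ hϖ₀ fun w hw => ?_)
    (fun k _ w hw => hasDerivAt_slice_update (A k) (Dn k) ϖ₀ (i k) w (hD k w hw))
    (fun w hw => hcert w hw) Φ hΦ hΦi
  · rw [map_pow]; exact pow_ne_zero 2 (hD k w hw)
  · rw [map_pow]; exact pow_ne_zero 2 (hD k w hw)

end Summit.KontsevichZagierPeriods.InverseLandau.TateFamilyKernel
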